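import Summits.QuantumFields.YangMills.Theorems.UnitScaleTiltProp7CombSymDiffL1XCurrencyT3
import Summits.QuantumFields.YangMills.Theorems.UnitScaleTiltProp7R0OfFrameRowsT3
import Summits.QuantumFields.YangMills.Theorems.UnitScaleTiltProp7CombTowerUnitaryOfSkew
import HarnessLib

/-!
# Route `UnitScaleTilt`, crux K1 «MinimiserStabilityRegPr» (stmt-QuantumFields-19200), route-R E′ (A′)-on-Σ, P-A2 row (β) of ✓p698006 — file «(β)-ASSEMBLY G2½»:
# **THE `hD` BINDER FROM THE COMB TOWER-MASS ROW `hMc` AND THE TWO ONE-TOWER SECOND-ORDER FRAME REMAINDER ROWS «REM2ˢ», «REM2ᶜ»**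

Cell `ym3-torus` (HUMAN RULING D-0037: YM₃ on the torus is ladder rung R3 — not d = 4, not a mass gap, not Clay), width seat `ym3-torus-px16` (gen 5).  `--supports stmt-QuantumFields-19200
--as helper`; THEOREMS ONLY (0 `def`, 0 `sorry`); count-neutral.

WHAT.  ✓p698006 `Prop7PA2OfSymDiffDivRows.hPA2_of_symL1_diffL1_divSlice` (== S30ᴸ ✓p701521) displays ONE open row (β) `hD`: the comb − sym chart-remainder difference in ℓ¹ on the `hcoS`
binder, `Σ_ĉ ‖C^{tw}_W(iX)(ĉ) − C^{twS}_W(iX)(ĉ)‖ ≤ CD₁·ℓ⁻¹·Σ_b‖X b‖² + CD₂·ℓ·(K_W(iX) + DIV_W(iX))` per `(L, B₁′)`.  This file proves `hD` VERBATIM from THREE displayed rows on the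
same binder, each `∀ L > 1, ∀ B₁′ > 0, ∃ (radius, L-only constants), ∀ ⟨binder⟩`:
* `hMc` — the COMB TOWER-MASS ROW («hMcomb», ★routeR-w6 g8 SIGNATURE-0 summand token for token at `A := fun b ↦ I•X b`, in `X`-letters with three constants `A B B′`; ★★OWNER g29
  06:31:31Z (a): «= px16's three-constant `hMc`», supplier lane (II) ★routeR-w1 g9 F-0…F-8, OPEN):
  `∀ l < K − n, Σ_{z,κ} ‖Ũ^{(l)}_{z,κ} − 1‖² ≤ A·M·(Lˡ)⁻¹ + (B·(K + DIV) + B′·(ℓ²)⁻¹·M)·Lˡ`;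
* `hRs` — «REM2ˢ» summed at the chart sites: `Σ_y ‖w^{s}_y(iX) − 1 − Dw^{s}_y(0)(iX)‖ ≤ Cs₁·ℓ⁻¹·M + Cs₂·ℓ·(K + DIV)` (px13 g6 F-β∕F-γ chain ✓p702081 ✓p702558 …, member knit OPEN);
* `hRc` — «REM2ᶜ» the same for the comb frame `w^{c}` (px17 g4 F-αᶜ∕F-βᶜ chain ⟸ «hMcomb₂», OPEN).
Everything else on the way to `hD` is discharged BY NAME: the comb accumulated-frame masses `Φᶜ, Φᶜ⁻¹ ⟸ hMc` (★routeR-w6 ✓p701781 `sum_normSq_frameTw_sub_one_le_of_hMcomb` at `Am := A·M`,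
`Bm := B·(K+DIV) + B′·(ℓ²)⁻¹·M`, `ε₀ := (12B₁′ + 1)·e` by lit ✓`regPr_mono` so that `nMax19 X < 2B₁′e < ε₀∕6`), the symmetric frame mass `Φˢ` (✓p699876), the frame sups and unitarity
(✓`norm_frameTw_sub_one_le_of_regPr`, ✓`norm_dbarTwS_sub_one_le`, ✓px17 `frameTw_mem_unitaryUnits_of_regPr`), the pointwise (R0) row (px13 ✓p699912 `siteRow_of_frameRows`), the (β) door
with (R0) and the masses (✓p700334 G1), the `M₀∕KD → X` exchange (★routeR-w4 ✓p695503) and ★routeR-w3's letter-free ✓`knit_arith` (T := 1, r₁ := 1, r₂ := 2∕L, Φˢ-weight 1662 = 1632 + 30).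

* §1 ★★ `sum_norm_CmapTw_sub_CmapTwS_le_X_of_frameRem2` — member level, `X`-currency: `Λ ≤ 30·Pc′ + 408·Pc + 6·Rs + 6·Rc + CD₁″(L,σ)·ℓ⁻¹·Σ‖D b‖² + CD₂″(L)·ℓ·(K_W(iD) + DIV_W(iD))`
  from the four abstract frame rows `Σ‖w^{c} − 1‖² ≤ Pc′`, `Σ‖(w^{c})⁻¹ − 1‖² ≤ Pc`, REM2ˢ `≤ Rs`, REM2ᶜ `≤ Rc`.
* §2 ★★★ `hD_of_hMcomb_of_rem2Rows (hMc) (hRs) (hRc) : ⟨✓p698006's hD, VERBATIM⟩` — radius `eD := min {eC, eS, eR, T⁻¹}`, `T := 10¹⁴L⁹ + 4·10¹¹L⁹·2B₁′ + 10⁷L⁴(12B₁′ + 1)`.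

HONEST SCOPE.  Bookkeeping∕assembly; the three displayed rows are OPEN (route-internal suppliers named above); nothing of (β)∕hPA2∕hcoS∕E′∕EX∕the crux is proved here; YM₃ on T³ is
rung R3 — NOT d = 4, NOT infinite volume, NOT a mass gap, NOT Clay.
[cite: Balaban1985Variational, (2) p.278, (15) p.280, (19)-(20) p.281, (44)-(48) pp.285-286, (106)-(111) p.294, Prop. 7 p.299; Balaban1985Averaging, (26)-(27) p.22, (89)-(92) p.31, (97) p.32,
(161)-(163) p.42; Balaban1985BackgroundPropagators, (3.3)-(3.8) pp.391-392]
-/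

noncomputable section

open scoped BigOperators Matrix.Norms.L2Operator Matrix Topology InnerProductSpace
open Filter NormedSpace

namespace Summit.QuantumFields.YangMills.Theorems.Prop7CombSymDiffL1XOfFrameRem2Rows

open Literature.MathematicalPhysics.QuantumFieldTheory.Balaban1983to89
open Literature.MathematicalPhysics.QuantumFieldTheory.Balaban1983to89.T3ContinuumYM3Torus
open Literature.MathematicalPhysics.QuantumFieldTheory.Balaban1983to89.T3PrintedRegularMinimiser
open MatrixLog (mlog)
open T4Continuum BlockAveraging AveragingRT ExpMeanLog BlockAveragingEMLLinearised BlockAveragingEMLLinearisedBackground BlockAveragingEMLProp2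
open B7Prop1Explicit (expUnit val_expUnit)
open B7Prop2Explicit (C0 c2' unitaryUnits)
open B7Prop3Flat (c3)
open B7Eq92Concrete (tildIter)
open B10Eq27TorusAxialLog (pull unitsField toUField)
open B9Eq39Adjoint (curl divB)
open B9TorusCalculus (torusT)
open T3SectALandauChart (emb15 eta eta_pos bgUnits In19 pos_of_regPr)
open Summit.QuantumFields.YangMills.Theorems.Prop7TPrint (expHermField)
open Summit.QuantumFields.YangMills.Theorems.Prop7SymAvgTw (frameTw QTw CmapTw)
open Summit.QuantumFields.YangMills.Theorems.Prop7SymAvgTwSym (frameTwS dbarTwS CmapTwS)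
open Summit.QuantumFields.YangMills.Theorems.Prop7ChartWindows (windowsS_of_small)
open Summit.QuantumFields.YangMills.Theorems.Prop7DbarTwWindow (norm_frameTw_sub_one_le_of_regPr)
open Summit.QuantumFields.YangMills.Theorems.Prop7DbarTwSymWindow (norm_dbarTwS_sub_one_le)
open Summit.QuantumFields.YangMills.Theorems.Prop7CombTowerUnitaryOfSkew (frameTw_mem_unitaryUnits_of_regPr)
open Summit.QuantumFields.YangMills.Theorems.Prop7SymFrameMassOfRegPr (sum_normSq_frameTwS_sub_one_le_of_regPr)
open Summit.QuantumFields.YangMills.Theorems.Prop7R0OfFrameRows (siteRow_of_frameRows sum_siteRow_of_frameRows)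
open Summit.QuantumFields.YangMills.Theorems.Prop7CombSymDiffL1OfR0FrameMasses (sum_norm_CmapTw_sub_CmapTwS_le_of_R0_combFrameMass)
open Summit.QuantumFields.YangMills.Theorems.Prop7CmapTwSJointRowX (knit_arith)
open Summit.QuantumFields.YangMills.Theorems.Prop7PertVarCurrencyExchange (sum_normSq_pertVar_le curlHS_pertVar_le_plaqK divHS_pertVar_le)
open Summit.QuantumFields.YangMills.Theorems.Prop7TwistedLevelMassOfRegPr (plaq_le_of_regPr)
open Summit.QuantumFields.YangMills.Theorems.Prop7Chart48SymUntwisted (unitsField_toUField_emb15_expHermField)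

variable (F : T3Family) (n K : ℕ)

/-! ## §1 The member theorem from four abstract frame rows — (a) `M₀∕KD` currency, (b) `X` currency -/

/-- ★★ **(a) THE (β) DIFFERENCE ROW FROM FOUR FRAME ROWS, `M₀∕KD` CURRENCY**: at `RegPr F n K ε₀ W`, `D` bondwise Hermitian traceless with `‖D b‖ ≤ σ·(L^{K−n})⁻¹`, windows
`10¹⁴L⁹ε₀ ≤ 1`, `0 ≤ σ`, `4·10¹¹L⁹σ ≤ 1`, and the four abstract frame rows `Σ_y‖w^c_y − 1‖² ≤ Pc′`, `Σ_y‖(w^c_y)⁻¹ − 1‖² ≤ Pc`, «REM2ˢ» `≤ Rs`, «REM2ᶜ» `≤ Rc`: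
`Σ_ĉ ‖C^{tw}_W(iD)(ĉ) − C^{twS}_W(iD)(ĉ)‖ ≤ 30Pc′ + 408Pc + 6Rs + 6Rc + 1662·Φˢ_top + 56·Z_top` (Φˢ_top, Z_top = the (n3) mass blocks of ✓p699876 ∕ ✓px17, as in G1) — (R0) pointwise
(px13 ✓`siteRow_of_frameRows`) with the frame sups∕unitarity discharged from `RegPr`, then G1 ✓`sum_norm_CmapTw_sub_CmapTwS_le_of_R0_combFrameMass` and Φˢ ✓p699876.
[cite: Balaban1985Variational, (19)-(20) p.281, (44)-(48) pp.285-286; Balaban1985Averaging, (26)-(27) p.22, (89)-(92) p.31, (97) p.32, (161)-(163) p.42] -/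
theorem sum_norm_CmapTw_sub_CmapTwS_le_of_frameRem2_masses (h : n ≤ K) {ε₀ σ : ℝ} (hε₀ : 0 < ε₀)
    (hWε : 100000000000000 * (F.L : ℝ) ^ 9 * ε₀ ≤ 1) (hσ0 : 0 ≤ σ) (hσL : 400000000000 * (F.L : ℝ) ^ 9 * σ ≤ 1)
    (W : GaugeField (F.P K) 0 (Matrix.specialUnitaryGroup (Fin 2) ℂ)) (hreg : RegPr F n K ε₀ W)
    (D : PBond (F.P K) 0 → Matrix (Fin 2) (Fin 2) ℂ) (hD : ∀ b : PBond (F.P K) 0, (D b).IsHermitian ∧ Matrix.trace (D b) = 0)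
    (hs : ∀ b : PBond (F.P K) 0, ‖D b‖ ≤ σ * ((F.L : ℝ) ^ (K - n))⁻¹)
    {Pc' Pc Rs Rc : ℝ}
    (hΦc' : ∑ y : Site (F.P n) 0, ‖((frameTw F n K h W (fun b => Complex.I • D b) y : (Matrix (Fin 2) (Fin 2) ℂ)ˣ) : Matrix (Fin 2) (Fin 2) ℂ) - 1‖ ^ 2 ≤ Pc')
    (hΦc : ∑ y : Site (F.P n) 0, ‖(((frameTw F n K h W (fun b => Complex.I • D b) y)⁻¹ : (Matrix (Fin 2) (Fin 2) ℂ)ˣ) : Matrix (Fin 2) (Fin 2) ℂ) - 1‖ ^ 2 ≤ Pc)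
    (hRs : ∑ y : Site (F.P n) 0, ‖((frameTwS F n K h W (fun b => Complex.I • D b) y : (Matrix (Fin 2) (Fin 2) ℂ)ˣ) : Matrix (Fin 2) (Fin 2) ℂ) - 1
            - fderiv ℂ (fun A : PBond (F.P K) 0 → Matrix (Fin 2) (Fin 2) ℂ => ((frameTwS F n K h W A y : (Matrix (Fin 2) (Fin 2) ℂ)ˣ) : Matrix (Fin 2) (Fin 2) ℂ)) 0 (fun b => Complex.I • D b)‖ ≤ Rs)
    (hRc : ∑ y : Site (F.P n) 0, ‖((frameTw F n K h W (fun b => Complex.I • D b) y : (Matrix (Fin 2) (Fin 2) ℂ)ˣ) : Matrix (Fin 2) (Fin 2) ℂ) - 1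
            - fderiv ℂ (fun A : PBond (F.P K) 0 → Matrix (Fin 2) (Fin 2) ℂ => ((frameTw F n K h W A y : (Matrix (Fin 2) (Fin 2) ℂ)ˣ) : Matrix (Fin 2) (Fin 2) ℂ)) 0 (fun b => Complex.I • D b)‖ ≤ Rc) :
    ∑ ĉ : PBond (F.P n) 0, ‖CmapTw F n K h W (fun b => Complex.I • D b) ĉ - CmapTwS F n K h W (fun b => Complex.I • D b) ĉ‖
      ≤ 30 * Pc' + 408 * Pc + 6 * Rs + 6 * Rc
        + 1662 * (2 * (F.L : ℝ) * (40 * (F.L : ℝ) ^ 2) * (7 * (∑ b : PBond (F.P K) 0, ‖pertVar W (emb15 W (expHermField D)) b‖ ^ 2) * ((F.L : ℝ) ^ (K - n))⁻¹)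
        + 40 * (F.L : ℝ) ^ 2 * ((28800 * (F.L : ℝ) ^ 4 * ((∑ x : Site (F.P K) 0, ∑ μ : Fin (F.P K).d, ∑ ν : Fin (F.P K).d,
            (if μ < ν then ∑ j : Fin 2, ∑ k : Fin 2,
              ‖(curl (torusT (F.P K) 0) (fun κ z => unitsField (toUField W) ⟨z, κ⟩) (fun κ z => pertVar W (emb15 W (expHermField D)) ⟨z, κ⟩) μ ν x) j k‖ ^ 2 else 0)) + (∑ x : Site (F.P K) 0, ∑ j : Fin 2, ∑ k : Fin 2,
            ‖(divB (torusT (F.P K) 0) (fun κ z => unitsField (toUField W) ⟨z, κ⟩) (fun κ z => pertVar W (emb15 W (expHermField D)) ⟨z, κ⟩) x) j k‖ ^ 2))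
            + 600000 * (F.L : ℝ) ^ 4 * (((F.L : ℝ) ^ (K - n)) ^ 2)⁻¹ * (∑ b : PBond (F.P K) 0, ‖pertVar W (emb15 W (expHermField D)) b‖ ^ 2)) * (F.L : ℝ) ^ (K - n)))
        + 56 * (((21 + 10080 * (F.L : ℝ) ^ 3) * ((∑ b : PBond (F.P K) 0, ‖pertVar W (emb15 W (expHermField D)) b‖ ^ 2) * ((F.L : ℝ) ^ (K - n))⁻¹)
          + (3 + 720 * (F.L : ℝ) ^ 2) * ((28800 * (F.L : ℝ) ^ 4 * ((∑ x : Site (F.P K) 0, ∑ μ : Fin (F.P K).d, ∑ ν : Fin (F.P K).d,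
            (if μ < ν then ∑ j : Fin 2, ∑ k : Fin 2,
              ‖(curl (torusT (F.P K) 0) (fun κ z => unitsField (toUField W) ⟨z, κ⟩) (fun κ z => pertVar W (emb15 W (expHermField D)) ⟨z, κ⟩) μ ν x) j k‖ ^ 2 else 0)) + (∑ x : Site (F.P K) 0, ∑ j : Fin 2, ∑ k : Fin 2,
            ‖(divB (torusT (F.P K) 0) (fun κ z => unitsField (toUField W) ⟨z, κ⟩) (fun κ z => pertVar W (emb15 W (expHermField D)) ⟨z, κ⟩) x) j k‖ ^ 2))
            + 600000 * (F.L : ℝ) ^ 4 * (((F.L : ℝ) ^ (K - n)) ^ 2)⁻¹ * (∑ b : PBond (F.P K) 0, ‖pertVar W (emb15 W (expHermField D)) b‖ ^ 2)) * (F.L : ℝ) ^ (K - n)))) := by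
  -- letters and windows
  have hL3 : (3 : ℝ) ≤ F.L := Prop7CurvedLandauKnitT3.three_le_L F
  have hL0 : (0 : ℝ) < F.L := by linarith
  have hL1 : (1 : ℝ) ≤ F.L := by linarith
  have hPL : ((F.P K).L : ℝ) = F.L := rfl
  have hℓ1 : (1 : ℝ) ≤ (F.L : ℝ) ^ (K - n) := one_le_pow₀ hL1
  have hℓ0 : (0 : ℝ) < (F.L : ℝ) ^ (K - n) := by positivity
  have hη : eta F n K = ((F.L : ℝ) ^ (K - n))⁻¹ := by rw [eta, inv_pow]
  -- the sup radius of `A = I•D` is `σ`: `‖A b‖ ≤ σ·η`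
  have hA : ∀ b, ‖(fun b => Complex.I • D b) b‖ ≤ σ * eta F n K := fun b => by
    show ‖Complex.I • D b‖ ≤ σ * eta F n K
    rw [hη, norm_smul, Complex.norm_I, one_mul]; exact hs b
  -- numeric windows (from `10¹⁴L⁹ε₀ ≤ 1`, `4·10¹¹L⁹σ ≤ 1`, `L ≥ 3`)
  have hL2 : (F.L : ℝ) ≤ (F.L : ℝ) ^ 2 := le_self_pow₀ hL1 two_ne_zero
  have hL23 : (F.L : ℝ) ^ 2 ≤ (F.L : ℝ) ^ 3 := pow_le_pow_right₀ hL1 (by norm_num)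
  have hL9 : (F.L : ℝ) ^ 2 ≤ (F.L : ℝ) ^ 9 := pow_le_pow_right₀ hL1 (by norm_num)
  have hL39 : (F.L : ℝ) ^ 3 ≤ (F.L : ℝ) ^ 9 := pow_le_pow_right₀ hL1 (by norm_num)
  have k1 : (F.L : ℝ) ^ 2 * σ ≤ (F.L : ℝ) ^ 9 * σ := mul_le_mul_of_nonneg_right hL9 hσ0
  have k2 : (F.L : ℝ) ^ 2 * ε₀ ≤ (F.L : ℝ) ^ 9 * ε₀ := mul_le_mul_of_nonneg_right hL9 hε₀.le
  have k3 : (F.L : ℝ) ^ 3 * ε₀ ≤ (F.L : ℝ) ^ 9 * ε₀ := mul_le_mul_of_nonneg_right hL39 hε₀.le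
  have k4 : (F.L : ℝ) * σ ≤ (F.L : ℝ) ^ 2 * σ := mul_le_mul_of_nonneg_right hL2 hσ0
  have k5 : (F.L : ℝ) ^ 2 * ε₀ ≤ (F.L : ℝ) ^ 3 * ε₀ := mul_le_mul_of_nonneg_right hL23 hε₀.le
  have he9 : 10 ^ 9 * (F.L : ℝ) ^ 2 * σ ≤ 1 := by linarith only [k1, hσL]
  have hε12 : 10 ^ 12 * (F.L : ℝ) ^ 3 * ε₀ ≤ 1 := by linarith only [k3, hWε]
  have hε9 : ε₀ * ((F.P K).L : ℝ) ^ 2 ≤ 1 / 10 ^ 9 := by rw [hPL]; linarith only [k2, hWε]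
  have hLe : (F.L : ℝ) * σ ≤ 1 / 10 ^ 9 := by linarith only [k4, k1, hσL]
  have hL2ε : (F.L : ℝ) ^ 2 * ε₀ ≤ 1 / 10 ^ 12 := by linarith only [k5, k3, hWε]
  -- `A = I•D` is skew
  have hAs : ∀ b, star ((fun b => Complex.I • D b) b) = -((fun b => Complex.I • D b) b) := fun b => by
    have hH := (hD b).1
    show star (Complex.I • D b) = -(Complex.I • D b)
    rw [star_smul, Complex.star_def, Complex.conj_I, Matrix.star_eq_conjTranspose, hH.eq, neg_smul]
  -- the fixed positive radius `e₁ := (10⁹L²)⁻¹ ≥ σ` for the comb frame windows (stated for `0 < e`)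
  set e₁ : ℝ := (10 ^ 9 * (F.L : ℝ) ^ 2)⁻¹ with he₁
  have hX0 : (0 : ℝ) < 10 ^ 9 * (F.L : ℝ) ^ 2 := by positivity
  have he₁0 : 0 < e₁ := by rw [he₁]; positivity
  have he₁X : e₁ * (10 ^ 9 * (F.L : ℝ) ^ 2) = 1 := by rw [he₁, inv_mul_cancel₀ hX0.ne']
  have hσe₁ : σ ≤ e₁ := by
    refine le_of_mul_le_mul_right ?_ hX0
    rw [he₁X]; linarith only [he9]
  have he₁9 : e₁ * ((F.P K).L : ℝ) ^ 2 ≤ 1 / 10 ^ 9 := by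
    rw [hPL]
    have : e₁ * (F.L : ℝ) ^ 2 = (e₁ * (10 ^ 9 * (F.L : ℝ) ^ 2)) / 10 ^ 9 := by ring
    rw [this, he₁X]
  have he₁6 : 10 ^ 6 * (F.L : ℝ) ^ 2 * e₁ ≤ 1 := by
    have : 10 ^ 6 * (F.L : ℝ) ^ 2 * e₁ = (e₁ * (10 ^ 9 * (F.L : ℝ) ^ 2)) / 10 ^ 3 := by ring
    rw [this, he₁X]; norm_num
  have hA1 : ∀ b, ‖(fun b => Complex.I • D b) b‖ ≤ e₁ * eta F n K :=
    fun b => (hA b).trans (mul_le_mul_of_nonneg_right hσe₁ (eta_pos F n K).le)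
  obtain ⟨hα3, hα4, -, -, hsmall, hc₃, hsm, -, -⟩ := windowsS_of_small F K hε₀ he₁0 hε9 he₁9
  -- the four pointwise frame letters of the (R0) door
  have h9 : (3 : ℝ) ^ 2 ≤ (F.L : ℝ) ^ 2 := pow_le_pow_left₀ (by norm_num) hL3 2
  have he₁s : e₁ ≤ 1 / (10 ^ 9 * 9) := by
    rw [he₁, one_div]; exact inv_anti₀ (by norm_num) (by linarith only [h9])
  have hpc8 : ∀ y : Site (F.P n) 0, ‖((frameTw F n K h W (fun b => Complex.I • D b) y : (Matrix (Fin 2) (Fin 2) ℂ)ˣ) : Matrix (Fin 2) (Fin 2) ℂ) - 1‖ ≤ 1 / 8 := fun y =>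
    (norm_frameTw_sub_one_le_of_regPr F h hε₀ he₁0.le hα3 hα4 hsmall hc₃ hsm W hreg (fun b => Complex.I • D b) hA1 y).1.trans (by linarith only [he₁s])
  have hcU : ∀ y : Site (F.P n) 0, ‖(((frameTw F n K h W (fun b => Complex.I • D b) y)⁻¹ : (Matrix (Fin 2) (Fin 2) ℂ)ˣ) : Matrix (Fin 2) (Fin 2) ℂ)‖ ≤ 1 := fun y =>
    (frameTw_mem_unitaryUnits_of_regPr F h hε₀ he₁0.le hα3 hα4 hsmall hc₃ he₁6 W hreg (fun b => Complex.I • D b) hA1 hAs y).2.2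
  have d0 : Fin (F.P n).d := ⟨0, by rw [T3Family.P_d]; norm_num⟩
  have hps8 : ∀ y : Site (F.P n) 0, ‖((frameTwS F n K h W (fun b => Complex.I • D b) y : (Matrix (Fin 2) (Fin 2) ℂ)ˣ) : Matrix (Fin 2) (Fin 2) ℂ) - 1‖ ≤ 1 / 8 := by
    intro y
    have h1 := (norm_dbarTwS_sub_one_le F h hε₀ hσ0 he9 hε12 W hreg (fun b => Complex.I • D b) hA ⟨y, d0⟩).2.1
    have hnum' : 30 * (F.L : ℝ) * (2 * σ + 2700 * (F.L : ℝ) * ε₀) ≤ 1 / 8 := by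
      have e1 : 30 * (F.L : ℝ) * (2 * σ + 2700 * (F.L : ℝ) * ε₀) = 60 * ((F.L : ℝ) * σ) + 81000 * ((F.L : ℝ) ^ 2 * ε₀) := by ring
      rw [e1]; linarith only [hLe, hL2ε]
    exact h1.trans hnum'
  -- (R0) pointwise and summed (px13 ✓p699912), with named frame letters
  obtain ⟨pc, hpc⟩ : ∃ pc : Site (F.P n) 0 → ℝ, pc = fun y => ‖((frameTw F n K h W (fun b => Complex.I • D b) y : (Matrix (Fin 2) (Fin 2) ℂ)ˣ) : Matrix (Fin 2) (Fin 2) ℂ) - 1‖ := ⟨_, rfl⟩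
  obtain ⟨ps, hps⟩ : ∃ ps : Site (F.P n) 0 → ℝ, ps = fun y => ‖((frameTwS F n K h W (fun b => Complex.I • D b) y : (Matrix (Fin 2) (Fin 2) ℂ)ˣ) : Matrix (Fin 2) (Fin 2) ℂ) - 1‖ := ⟨_, rfl⟩
  obtain ⟨rs, hrs⟩ : ∃ rs : Site (F.P n) 0 → ℝ, rs = fun y => ‖((frameTwS F n K h W (fun b => Complex.I • D b) y : (Matrix (Fin 2) (Fin 2) ℂ)ˣ) : Matrix (Fin 2) (Fin 2) ℂ) - 1
            - fderiv ℂ (fun A : PBond (F.P K) 0 → Matrix (Fin 2) (Fin 2) ℂ => ((frameTwS F n K h W A y : (Matrix (Fin 2) (Fin 2) ℂ)ˣ) : Matrix (Fin 2) (Fin 2) ℂ)) 0 (fun b => Complex.I • D b)‖ := ⟨_, rfl⟩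
  obtain ⟨rc, hrc⟩ : ∃ rc : Site (F.P n) 0 → ℝ, rc = fun y => ‖((frameTw F n K h W (fun b => Complex.I • D b) y : (Matrix (Fin 2) (Fin 2) ℂ)ˣ) : Matrix (Fin 2) (Fin 2) ℂ) - 1
            - fderiv ℂ (fun A : PBond (F.P K) 0 → Matrix (Fin 2) (Fin 2) ℂ => ((frameTw F n K h W A y : (Matrix (Fin 2) (Fin 2) ℂ)ˣ) : Matrix (Fin 2) (Fin 2) ℂ)) 0 (fun b => Complex.I • D b)‖ := ⟨_, rfl⟩
  have hpc_le : ∀ y : Site (F.P n) 0, ‖((frameTw F n K h W (fun b => Complex.I • D b) y : (Matrix (Fin 2) (Fin 2) ℂ)ˣ) : Matrix (Fin 2) (Fin 2) ℂ) - 1‖ ≤ pc y := fun y => by rw [hpc]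
  have hps_le : ∀ y : Site (F.P n) 0, ‖((frameTwS F n K h W (fun b => Complex.I • D b) y : (Matrix (Fin 2) (Fin 2) ℂ)ˣ) : Matrix (Fin 2) (Fin 2) ℂ) - 1‖ ≤ ps y := fun y => by rw [hps]
  have hrs_le : ∀ y : Site (F.P n) 0, ‖((frameTwS F n K h W (fun b => Complex.I • D b) y : (Matrix (Fin 2) (Fin 2) ℂ)ˣ) : Matrix (Fin 2) (Fin 2) ℂ) - 1
            - fderiv ℂ (fun A : PBond (F.P K) 0 → Matrix (Fin 2) (Fin 2) ℂ => ((frameTwS F n K h W A y : (Matrix (Fin 2) (Fin 2) ℂ)ˣ) : Matrix (Fin 2) (Fin 2) ℂ)) 0 (fun b => Complex.I • D b)‖ ≤ rs y := fun y => by rw [hrs]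
  have hrc_le : ∀ y : Site (F.P n) 0, ‖((frameTw F n K h W (fun b => Complex.I • D b) y : (Matrix (Fin 2) (Fin 2) ℂ)ˣ) : Matrix (Fin 2) (Fin 2) ℂ) - 1
            - fderiv ℂ (fun A : PBond (F.P K) 0 → Matrix (Fin 2) (Fin 2) ℂ => ((frameTw F n K h W A y : (Matrix (Fin 2) (Fin 2) ℂ)ˣ) : Matrix (Fin 2) (Fin 2) ℂ)) 0 (fun b => Complex.I • D b)‖ ≤ rc y := fun y => by rw [hrc]
  have hpc8' : ∀ y, pc y ≤ 1 / 8 := fun y => by rw [hpc]; exact hpc8 y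
  have hps8' : ∀ y, ps y ≤ 1 / 8 := fun y => by rw [hps]; exact hps8 y
  have hrow := siteRow_of_frameRows F h W (fun b => Complex.I • D b) pc ps rs rc hpc_le hpc8' hps_le hps8' hcU hrs_le hrc_le
  have hsum := (Finset.sum_le_sum fun y (_ : y ∈ Finset.univ) => hrow y).trans_eq (sum_siteRow_of_frameRows F (n := n) pc ps rs rc)
  have h1 : ∑ y : Site (F.P n) 0, pc y ^ 2 ≤ Pc' := by rw [hpc]; exact hΦc'
  have h3 : ∑ y : Site (F.P n) 0, rs y ≤ Rs := by rw [hrs]; exact hRs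
  have h4 : ∑ y : Site (F.P n) 0, rc y ≤ Rc := by rw [hrc]; exact hRc
  have hR0 : ∑ y : Site (F.P n) 0, ‖mlog ((((frameTw F n K h W (fun b => Complex.I • D b) y)⁻¹ * frameTwS F n K h W (fun b => Complex.I • D b) y : (Matrix (Fin 2) (Fin 2) ℂ)ˣ) : Matrix (Fin 2) (Fin 2) ℂ))
          - (fderiv ℂ (fun A : PBond (F.P K) 0 → Matrix (Fin 2) (Fin 2) ℂ => ((frameTwS F n K h W A y : (Matrix (Fin 2) (Fin 2) ℂ)ˣ) : Matrix (Fin 2) (Fin 2) ℂ)) 0 (fun b => Complex.I • D b)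
              - fderiv ℂ (fun A : PBond (F.P K) 0 → Matrix (Fin 2) (Fin 2) ℂ => ((frameTw F n K h W A y : (Matrix (Fin 2) (Fin 2) ℂ)ˣ) : Matrix (Fin 2) (Fin 2) ℂ)) 0 (fun b => Complex.I • D b))‖
      ≤ 5 * (Pc' + ∑ y : Site (F.P n) 0, ps y ^ 2) + Rs + Rc := by linarith only [hsum, h1, h3, h4]
  -- the (n3)-currency sup data `s := σ·ℓ⁻¹` and G1 at this datum
  have hs0 : 0 ≤ σ * ((F.L : ℝ) ^ (K - n))⁻¹ := by positivity
  have hs4 : 4 * (σ * ((F.L : ℝ) ^ (K - n))⁻¹) ≤ 1 := by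
    have hu1 : ((F.L : ℝ) ^ (K - n))⁻¹ ≤ 1 := inv_le_one_of_one_le₀ hℓ1
    have h1 : σ * ((F.L : ℝ) ^ (K - n))⁻¹ ≤ σ := mul_le_of_le_one_right hσ0 hu1
    have h9' : (1 : ℝ) ≤ (F.L : ℝ) ^ 9 := one_le_pow₀ hL1
    have h2 : σ ≤ (F.L : ℝ) ^ 9 * σ := le_mul_of_one_le_left hσ0 h9'
    linarith only [h1, h2, hσL]
  have hsL : 400000000000 * (F.L : ℝ) ^ 9 * (((F.L : ℝ) ^ (K - n)) * (σ * ((F.L : ℝ) ^ (K - n))⁻¹)) ≤ 1 := by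
    rw [show (F.L : ℝ) ^ (K - n) * (σ * ((F.L : ℝ) ^ (K - n))⁻¹) = σ by field_simp]
    exact hσL
  have hG1 := sum_norm_CmapTw_sub_CmapTwS_le_of_R0_combFrameMass F n K h hε₀ hWε hs0 hs4 hsL hreg D hD hs hR0 hΦc
  have hΦs : ∑ y : Site (F.P n) 0, ps y ^ 2
      ≤ (2 * (F.L : ℝ) * (40 * (F.L : ℝ) ^ 2) * (7 * (∑ b : PBond (F.P K) 0, ‖pertVar W (emb15 W (expHermField D)) b‖ ^ 2) * ((F.L : ℝ) ^ (K - n))⁻¹)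
        + 40 * (F.L : ℝ) ^ 2 * ((28800 * (F.L : ℝ) ^ 4 * ((∑ x : Site (F.P K) 0, ∑ μ : Fin (F.P K).d, ∑ ν : Fin (F.P K).d,
            (if μ < ν then ∑ j : Fin 2, ∑ k : Fin 2,
              ‖(curl (torusT (F.P K) 0) (fun κ z => unitsField (toUField W) ⟨z, κ⟩) (fun κ z => pertVar W (emb15 W (expHermField D)) ⟨z, κ⟩) μ ν x) j k‖ ^ 2 else 0)) + (∑ x : Site (F.P K) 0, ∑ j : Fin 2, ∑ k : Fin 2,
            ‖(divB (torusT (F.P K) 0) (fun κ z => unitsField (toUField W) ⟨z, κ⟩) (fun κ z => pertVar W (emb15 W (expHermField D)) ⟨z, κ⟩) x) j k‖ ^ 2))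
            + 600000 * (F.L : ℝ) ^ 4 * (((F.L : ℝ) ^ (K - n)) ^ 2)⁻¹ * (∑ b : PBond (F.P K) 0, ‖pertVar W (emb15 W (expHermField D)) b‖ ^ 2)) * (F.L : ℝ) ^ (K - n))) := by
    rw [hps]; exact sum_normSq_frameTwS_sub_one_le_of_regPr F n K h hε₀ hWε hs0 hs4 hsL hreg D hD hs
  linarith only [hG1, hΦs]

set_option maxHeartbeats 400000 in
-- HEARTBEAT rule (README): as in the sibling G2 file ✓p701274 — `knit_arith`'s 30-argument instantiation against the JOINT plaquette form and the two (n3) mass blocks measures > 200k.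
/-- ★★ **(b) THE SAME IN `X`-CURRENCY**: `Σ_ĉ ‖C^{tw}_W(iD)(ĉ) − C^{twS}_W(iD)(ĉ)‖ ≤ 30Pc′ + 408Pc + 6Rs + 6Rc + CD₁″(L,σ)·(L^{K−n})⁻¹·Σ_b‖D b‖² + CD₂″(L)·L^{K−n}·(K_W(iD) + DIV_W(iD))`
— (a) read through ★routeR-w4's exchange ✓`Prop7PertVarCurrencyExchange` and ★routeR-w3's letter-free ✓`knit_arith` (`T := 1`, `r₁ := 1`, `r₂ := 2∕L`, Φˢ-weight `1662 = 1632 + 5·6`).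
[cite: Balaban1985Variational, (15) p.280, (19)-(20) p.281, (44)-(48) pp.285-286; Balaban1985BackgroundPropagators, (3.3)-(3.8) pp.391-392; Balaban1985Averaging, (89)-(92) p.31] -/
theorem sum_norm_CmapTw_sub_CmapTwS_le_X_of_frameRem2 (h : n ≤ K) {ε₀ σ : ℝ} (hε₀ : 0 < ε₀)
    (hWε : 100000000000000 * (F.L : ℝ) ^ 9 * ε₀ ≤ 1) (hσ0 : 0 ≤ σ) (hσL : 400000000000 * (F.L : ℝ) ^ 9 * σ ≤ 1)
    (W : GaugeField (F.P K) 0 (Matrix.specialUnitaryGroup (Fin 2) ℂ)) (hreg : RegPr F n K ε₀ W)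
    (D : PBond (F.P K) 0 → Matrix (Fin 2) (Fin 2) ℂ) (hD : ∀ b : PBond (F.P K) 0, (D b).IsHermitian ∧ Matrix.trace (D b) = 0)
    (hs : ∀ b : PBond (F.P K) 0, ‖D b‖ ≤ σ * ((F.L : ℝ) ^ (K - n))⁻¹)
    {Pc' Pc Rs Rc : ℝ}
    (hΦc' : ∑ y : Site (F.P n) 0, ‖((frameTw F n K h W (fun b => Complex.I • D b) y : (Matrix (Fin 2) (Fin 2) ℂ)ˣ) : Matrix (Fin 2) (Fin 2) ℂ) - 1‖ ^ 2 ≤ Pc')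
    (hΦc : ∑ y : Site (F.P n) 0, ‖(((frameTw F n K h W (fun b => Complex.I • D b) y)⁻¹ : (Matrix (Fin 2) (Fin 2) ℂ)ˣ) : Matrix (Fin 2) (Fin 2) ℂ) - 1‖ ^ 2 ≤ Pc)
    (hRs : ∑ y : Site (F.P n) 0, ‖((frameTwS F n K h W (fun b => Complex.I • D b) y : (Matrix (Fin 2) (Fin 2) ℂ)ˣ) : Matrix (Fin 2) (Fin 2) ℂ) - 1
            - fderiv ℂ (fun A : PBond (F.P K) 0 → Matrix (Fin 2) (Fin 2) ℂ => ((frameTwS F n K h W A y : (Matrix (Fin 2) (Fin 2) ℂ)ˣ) : Matrix (Fin 2) (Fin 2) ℂ)) 0 (fun b => Complex.I • D b)‖ ≤ Rs)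
    (hRc : ∑ y : Site (F.P n) 0, ‖((frameTw F n K h W (fun b => Complex.I • D b) y : (Matrix (Fin 2) (Fin 2) ℂ)ˣ) : Matrix (Fin 2) (Fin 2) ℂ) - 1
            - fderiv ℂ (fun A : PBond (F.P K) 0 → Matrix (Fin 2) (Fin 2) ℂ => ((frameTw F n K h W A y : (Matrix (Fin 2) (Fin 2) ℂ)ˣ) : Matrix (Fin 2) (Fin 2) ℂ)) 0 (fun b => Complex.I • D b)‖ ≤ Rc) :
    ∑ ĉ : PBond (F.P n) 0, ‖CmapTw F n K h W (fun b => Complex.I • D b) ĉ - CmapTwS F n K h W (fun b => Complex.I • D b) ĉ‖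
      ≤ 30 * Pc' + 408 * Pc + 6 * Rs + 6 * Rc
        + (1 * (2 * (F.L : ℝ) * (1662 * 560 * (F.L : ℝ) ^ 3 + 56 * (21 + 10080 * (F.L : ℝ) ^ 3)) + 2 / (F.L : ℝ) * (((1662 * (40 * (F.L : ℝ) ^ 2) + 56 * (3 + 720 * (F.L : ℝ) ^ 2)) * (28800 * (F.L : ℝ) ^ 4) * ((F.L : ℝ) / 2)) * (384 + 60 * σ ^ 2) + ((1662 * (40 * (F.L : ℝ) ^ 2) + 56 * (3 + 720 * (F.L : ℝ) ^ 2)) * (600000 * (F.L : ℝ) ^ 4) * ((F.L : ℝ) / 2)))))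
          * ((F.L : ℝ) ^ (K - n))⁻¹ * (∑ b : PBond (F.P K) 0, ‖D b‖ ^ 2)
        + (1 * (2 / (F.L : ℝ) * (8 * ((1662 * (40 * (F.L : ℝ) ^ 2) + 56 * (3 + 720 * (F.L : ℝ) ^ 2)) * (28800 * (F.L : ℝ) ^ 4) * ((F.L : ℝ) / 2))))) * (F.L : ℝ) ^ (K - n) *
          ((∑ p : Plaq (F.P K) 0, ‖((Complex.I • D ⟨p.src, p.μ⟩) + ((W ⟨p.src, p.μ⟩ : Matrix (Fin 2) (Fin 2) ℂ) * (Complex.I • D ⟨p.src.shift p.μ, p.ν⟩) * star (W ⟨p.src, p.μ⟩ : Matrix (Fin 2) (Fin 2) ℂ))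
            - (((W ⟨p.src, p.μ⟩ * W ⟨p.src.shift p.μ, p.ν⟩ * (W ⟨p.src.shift p.ν, p.μ⟩)⁻¹ : Matrix.specialUnitaryGroup (Fin 2) ℂ) : Matrix (Fin 2) (Fin 2) ℂ) * (Complex.I • D ⟨p.src.shift p.ν, p.μ⟩) * star ((W ⟨p.src, p.μ⟩ * W ⟨p.src.shift p.μ, p.ν⟩ * (W ⟨p.src.shift p.ν, p.μ⟩)⁻¹ : Matrix.specialUnitaryGroup (Fin 2) ℂ) : Matrix (Fin 2) (Fin 2) ℂ))
            - (((GaugeField.plaqHol W p : Matrix.specialUnitaryGroup (Fin 2) ℂ) : Matrix (Fin 2) (Fin 2) ℂ) * (Complex.I • D ⟨p.src, p.ν⟩) * star ((GaugeField.plaqHol W p : Matrix.specialUnitaryGroup (Fin 2) ℂ) : Matrix (Fin 2) (Fin 2) ℂ)))‖ ^ 2) + (∑ x : Site (F.P K) 0, ∑ j : Fin 2, ∑ k : Fin 2,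
              ‖(divB (torusT (F.P K) 0) (fun κ z => unitsField (toUField W) ⟨z, κ⟩) (fun κ z => Complex.I • D ⟨z, κ⟩) x) j k‖ ^ 2)) := by
  -- letters
  have hL3 : (3 : ℝ) ≤ F.L := Prop7CurvedLandauKnitT3.three_le_L F
  have hL0 : (0 : ℝ) < F.L := by linarith
  have hL1 : (1 : ℝ) ≤ F.L := by linarith
  have hℓ1 : (1 : ℝ) ≤ (F.L : ℝ) ^ (K - n) := one_le_pow₀ hL1
  have hℓ0 : (0 : ℝ) < (F.L : ℝ) ^ (K - n) := by positivity
  -- §1a at this datum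
  have h1a := sum_norm_CmapTw_sub_CmapTwS_le_of_frameRem2_masses F n K h hε₀ hWε hσ0 hσL W hreg D hD hs hΦc' hΦc hRs hRc
  -- the currency exchange (★routeR-w4)
  have hcomp := unitsField_toUField_emb15_expHermField F W D hD
  have hU : ∀ b : PBond (F.P K) 0, ((emb15 W (expHermField D) b : Matrix.specialUnitaryGroup (Fin 2) ℂ) : Matrix (Fin 2) (Fin 2) ℂ) =
      exp (Complex.I • D b) * ((W b : Matrix.specialUnitaryGroup (Fin 2) ℂ) : Matrix (Fin 2) (Fin 2) ℂ) := by
    intro b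
    have h1 := congrArg (fun u : (Matrix (Fin 2) (Fin 2) ℂ)ˣ => (u : Matrix (Fin 2) (Fin 2) ℂ)) (congrFun hcomp b)
    simp only [Units.val_mul, val_expUnit] at h1
    exact h1
  have hX : ∀ b : PBond (F.P K) 0, (D b).IsHermitian := fun b => (hD b).1
  have hM₀ := sum_normSq_pertVar_le W (emb15 W (expHermField D)) D hX hU
  have ha := plaq_le_of_regPr F n K hreg
  have hCU := curlHS_pertVar_le_plaqK W (emb15 W (expHermField D)) D hX hU hs ha
  have hDV := divHS_pertVar_le W (emb15 W (expHermField D)) D hX hU hs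
  have hε₀1 : ε₀ ≤ 1 := by
    have h9' : (1 : ℝ) ≤ (F.L : ℝ) ^ 9 := one_le_pow₀ hL1
    have : ε₀ ≤ (F.L : ℝ) ^ 9 * ε₀ := le_mul_of_one_le_left hε₀.le h9'
    linarith only [this, hWε, hε₀.le]
  have hd : ((F.P K).d : ℝ) = 3 := by rw [T3Family.P_d F K]; norm_num
  have hCU0 : 0 ≤ ∑ x : Site (F.P K) 0, ∑ μ : Fin (F.P K).d, ∑ ν : Fin (F.P K).d,
      (if μ < ν then ∑ j : Fin 2, ∑ k : Fin 2,
        ‖(curl (torusT (F.P K) 0) (fun κ z => unitsField (toUField W) ⟨z, κ⟩) (fun κ z => pertVar W (emb15 W (expHermField D)) ⟨z, κ⟩) μ ν x) j k‖ ^ 2 else 0) := by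
    refine Finset.sum_nonneg fun x _ => Finset.sum_nonneg fun μ _ => Finset.sum_nonneg fun ν _ => ?_
    split_ifs
    · positivity
    · exact le_rfl
  have hPc0 : 0 ≤ Pc := le_trans (Finset.sum_nonneg fun _ _ => sq_nonneg _) hΦc
  have hPc'0 : 0 ≤ Pc' := le_trans (Finset.sum_nonneg fun _ _ => sq_nonneg _) hΦc'
  have hRs0 : 0 ≤ Rs := le_trans (Finset.sum_nonneg fun _ _ => norm_nonneg _) hRs
  have hRc0 : 0 ≤ Rc := le_trans (Finset.sum_nonneg fun _ _ => norm_nonneg _) hRc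
  -- §1a's mass block rewritten in `knit_arith`'s shape (`T := 1`, `r₁ := 1`, `r₂ := 2∕L`; Φˢ-weight 1662)
  have hshape : ∀ (M₀ KD Λ : ℝ),
      Λ ≤ 30 * Pc' + 408 * Pc + 6 * Rs + 6 * Rc
        + 1662 * (2 * (F.L : ℝ) * (40 * (F.L : ℝ) ^ 2) * (7 * M₀ * ((F.L : ℝ) ^ (K - n))⁻¹)
          + 40 * (F.L : ℝ) ^ 2 * ((28800 * (F.L : ℝ) ^ 4 * KD + 600000 * (F.L : ℝ) ^ 4 * (((F.L : ℝ) ^ (K - n)) ^ 2)⁻¹ * M₀) * (F.L : ℝ) ^ (K - n)))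
        + 56 * ((21 + 10080 * (F.L : ℝ) ^ 3) * (M₀ * ((F.L : ℝ) ^ (K - n))⁻¹)
          + (3 + 720 * (F.L : ℝ) ^ 2) * ((28800 * (F.L : ℝ) ^ 4 * KD + 600000 * (F.L : ℝ) ^ 4 * (((F.L : ℝ) ^ (K - n)) ^ 2)⁻¹ * M₀) * (F.L : ℝ) ^ (K - n))) →
      Λ - (30 * Pc' + 408 * Pc + 6 * Rs + 6 * Rc)
        ≤ 1 * ((1662 * 560 * (F.L : ℝ) ^ 3 + 56 * (21 + 10080 * (F.L : ℝ) ^ 3)) * M₀ * 1 * ((F.L : ℝ) ^ (K - n))⁻¹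
          + (((1662 * (40 * (F.L : ℝ) ^ 2) + 56 * (3 + 720 * (F.L : ℝ) ^ 2)) * (28800 * (F.L : ℝ) ^ 4) * ((F.L : ℝ) / 2)) * KD
              + ((1662 * (40 * (F.L : ℝ) ^ 2) + 56 * (3 + 720 * (F.L : ℝ) ^ 2)) * (600000 * (F.L : ℝ) ^ 4) * ((F.L : ℝ) / 2)) * 1 * (((F.L : ℝ) ^ (K - n)) ^ 2)⁻¹ * M₀)
            * (2 / (F.L : ℝ)) * (F.L : ℝ) ^ (K - n)) := by
    intro M₀ KD Λ hΛ
    have e : 1662 * (2 * (F.L : ℝ) * (40 * (F.L : ℝ) ^ 2) * (7 * M₀ * ((F.L : ℝ) ^ (K - n))⁻¹)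
          + 40 * (F.L : ℝ) ^ 2 * ((28800 * (F.L : ℝ) ^ 4 * KD + 600000 * (F.L : ℝ) ^ 4 * (((F.L : ℝ) ^ (K - n)) ^ 2)⁻¹ * M₀) * (F.L : ℝ) ^ (K - n)))
        + 56 * ((21 + 10080 * (F.L : ℝ) ^ 3) * (M₀ * ((F.L : ℝ) ^ (K - n))⁻¹)
          + (3 + 720 * (F.L : ℝ) ^ 2) * ((28800 * (F.L : ℝ) ^ 4 * KD + 600000 * (F.L : ℝ) ^ 4 * (((F.L : ℝ) ^ (K - n)) ^ 2)⁻¹ * M₀) * (F.L : ℝ) ^ (K - n)))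
      = 1 * ((1662 * 560 * (F.L : ℝ) ^ 3 + 56 * (21 + 10080 * (F.L : ℝ) ^ 3)) * M₀ * 1 * ((F.L : ℝ) ^ (K - n))⁻¹
          + (((1662 * (40 * (F.L : ℝ) ^ 2) + 56 * (3 + 720 * (F.L : ℝ) ^ 2)) * (28800 * (F.L : ℝ) ^ 4) * ((F.L : ℝ) / 2)) * KD
              + ((1662 * (40 * (F.L : ℝ) ^ 2) + 56 * (3 + 720 * (F.L : ℝ) ^ 2)) * (600000 * (F.L : ℝ) ^ 4) * ((F.L : ℝ) / 2)) * 1 * (((F.L : ℝ) ^ (K - n)) ^ 2)⁻¹ * M₀)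
            * (2 / (F.L : ℝ)) * (F.L : ℝ) ^ (K - n)) := by
      field_simp
      ring
    linarith [hΛ, e.le, e.ge]
  have hS := hshape _ _ _ h1a
  have hr₂0 : (0 : ℝ) ≤ 2 / (F.L : ℝ) := by positivity
  have hk := knit_arith (T := 1) (r₁ := 1) (r₂ := 2 / (F.L : ℝ))
    hL3 hℓ0 hℓ1 rfl (by norm_num) hε₀.le hε₀1 (by positivity) (by positivity) hM₀
    (by positivity) (by positivity) (by positivity) (by positivity) (by positivity) (by norm_num) (by linarith) hr₂0 le_rfl
    (by norm_num : ((2 : ℕ) : ℝ) = 2) hd (by rw [inv_pow]) rfl hCU0 hCU (by positivity) hDV hS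
  linarith only [hk]

end Summit.QuantumFields.YangMills.Theorems.Prop7CombSymDiffL1XOfFrameRem2Rows

end
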